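import Summits.QuantumFields.YangMills.Theorems.BalabanUVNodesN15TwoGridConsistency
import Literature.MathematicalPhysics.QuantumFieldTheory.Balaban1983to89.B5Prop12GHolds
import Literature.MathematicalPhysics.QuantumFieldTheory.Balaban1983to89.B5Cube1Partition
import HarnessLib

/-!
# Route «BalabanUVNodes», node N15 = NE2, -a lane, part 39: THE STABILITY SIDE OF DOOR (iv) — Bałaban's PROPOSITION 1.2 (1.110), ENTRIES «GJ», «∇GJ», «G∇*J», FOR
# `G = Δ_a⁻¹` ON THE TORUS FAMILY OF RECORD, READ AS BLOCK MAJORANTS `C·e^{−δ₀|y−y′|_T}` OF THE REAL OPERATORS `G`, `ρ(n(s_ν−1))∘G`, `G∘ρ(n(s_ν⁻¹−1))` ON THE N15 CARRIER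

Cell `pub-ymgap`, seat `pub-ymgap-dag-n15-a` (KNIT-BY-NAME, g11; D-0062; chair R424 venue; `bears_on: R4∕N15`); `--supports stmt-QuantumFields-19910 --as helper`.
Door (iv) of `HOME/pub-ymgap-dag-n15-a/DOOR-IV-PLAN.md` §7.2∕§7.4(c) (route R, file R3-U), over parts 34∕35 (`…N15TwoGridTransports`∕`…Consistency`: the symbol map `symbOp = ρ`,
`sD`, `sTinv`).  The resolvent identity `𝔇(G′, G) = −G′·(Δ′_aP̂₂ − PΔ_a)·G` (`T4EtaRateDefect.idef_inv`) needs, besides the CONSISTENCY operator (parts 34∕35∕37, divergence ∕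
`O(η)` form), the STABILITY of `G′` and `G` in the lineage's block-majorant currency `B11SectG.HasMaj (BlockNorm.ofBlocks (unitTorusGeo L K M) blkFine)`: the three sup
entries of (1.110).  They are IN THE TREE, hypothesis-free, for Bałaban's torus family of record — `B5Prop12GHolds.prop12_famG_printed : B5.Prop12Printed (famG d L a)`
(lit-balaban p37∕p38∕r02; `famG d L a i = B5SettingP12Real.latticeSettingP12R (nP i.P) (MP i.P) a i.P.K`, `n = L^K`, `M_μ = 2L^m`) — but in the abstract `B5.Setting`
currency (`e`, `suppIn`, `supNorm`, `dist`) over the complex matrix `(DeltaA n M a)⁻¹` acting on `Complex.ofReal`-embedded sources.  THIS FILE reads them off: King's block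
`B(y) ⊂ Δ̃(y)` (`B5Cube1Partition.cube1_subset_cubeT`), `distSite = tdistT` (`B5Ineq110P12Lattice.natAbs_valMinAbs_intCast_sub`, `B4Sect5Torus.ccoord_cast`), the real
operator `B5RealFields.GR = reM (DeltaA⁻¹)` (`GR_map_ofReal`, `DeltaAR_mul_GR`, `GR_mul_DeltaAR`), `fdiff`∕`fdiffᴴ` on embedded real 1-forms = `ρ(n(s_ν − 1))`∕
`ρ(n(s_ν⁻¹ − 1))`.  NOTHING of [B5] is asserted: the (1.110) inequalities are the tree's theorem; this file is its DICTIONARY into the N15 currency.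
CONTENTS.  §13 `blockLabel_eq_blockOf`, `mem_cubeT_blockOf` (`x ∈ Δ̃(B(x))`), ★ `distSite_eq_tdistT`.  §14 `gOp` ∕ `deltaOp` (`Matrix.mulVecLin GR ∕ DeltaAR`),
`DeltaA_inv_mulVec_ofReal` (dictionary), `gOp_comp_deltaOp` ∕ `deltaOp_comp_gOp` (`GΔ_a = Δ_aG = 1`, the two slots of `idef_inv`).  §15 `paramsOf` ∕ `topIdxOf` (the N15
carrier's volume as an index of `famG (d+1) L a`), `famG_topIdxOf` (`rfl`), ★★ **`hasMaj_gOp`** (entry «GJ»: `∃ δ₀ C > 0, ∀ m K ≥ 1, HasMaj … (gOp (2L^m) (L^K) a) (C·e^{−δ₀ tdistT})`).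
§16 `fdiff_mulVec_ofReal`, `star_fdiff_mulVec_ofReal` (dictionaries).  §17 ★★ **`hasMaj_entries110`** (entries «∇GJ» and «G∇*J» for every direction `ν`, ONE pair `(δ₀, C)`:
`HasMaj … (ρ(L^K(s_ν−1)) ∘ gOp …)` and `HasMaj … (gOp … ∘ ρ(L^K(s_ν⁻¹−1)))`, the latter through the TENSOR source `J_{ν′} = [ν′ = ν]·μ` of `eL 2`).
Plumbing defs are DATA (`gOp`, `deltaOp`, `paramsOf`, `topIdxOf`; no `Prop`-valued def).
HONEST FRAMING ∕ LIMITS.  Dictionary + bookkeeping; the estimate is the tree's `prop12_famG_printed` (kernel-proved there, Combes–Thomas route, its own disclosed divergences);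
unit blocks in place of the printed doubled cubes on BOTH sides (weaker localisation of the source, same conclusion); tori of record `M_μ = 2L^m` only; `U ≡ 1`; the Hölder
(1.111) ∕ (1.112) entries and the η-rate itself (R3 proper) are NOT here; NOT Node 00; count-neutral (typed 28∕28 · discharged 5∕28 unchanged); NOT a discharge of N15
(object-bound; NE2⁺ NOT PRINTED); one finite T⁴ at fixed ε — NOT infinite volume, NOT OS on ℝ⁴, NOT a mass gap, NOT Clay.
-/

noncomputable section

open scoped BigOperators Matrix
open Finset

namespace Summit.QuantumFields.YangMills.BalabanUVNodes.N15.TwoGrid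

open Literature.MathematicalPhysics.QuantumFieldTheory.Balaban1983to89
open Literature.MathematicalPhysics.QuantumFieldTheory.Balaban1983to89.B11SectG (BlockNorm HasMaj)
open Literature.MathematicalPhysics.QuantumFieldTheory.Balaban1983to89.B11AxialTransport190 (abs_le_loc_ofBlocks loc_ofBlocks_le)
open Literature.MathematicalPhysics.QuantumFieldTheory.Balaban1983to89.T4EtaRateCoeffDefect (pull pull_apply fibre mem_fibre)
open Literature.MathematicalPhysics.QuantumFieldTheory.Balaban1983to89.B5Prop11Plancherel (Tor fine unitVec fdiff)
open Literature.MathematicalPhysics.QuantumFieldTheory.Balaban1983to89.B5DeltaA169 (DeltaA)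
open Literature.MathematicalPhysics.QuantumFieldTheory.Balaban1983to89.B5RealFields (GR DeltaAR reM GR_map_ofReal DeltaAR_mul_GR GR_mul_DeltaAR)
open Literature.MathematicalPhysics.QuantumFieldTheory.Balaban1983to89.B5Prop12FieldsLattice (cubeT cubeB cdistF toFine distSite suppInL supNormL eL)
open Literature.MathematicalPhysics.QuantumFieldTheory.Balaban1983to89.B5Cube1Partition (blockLabel blockLabel_val mem_cube1_iff cube1_subset_cubeT)
open Literature.MathematicalPhysics.QuantumFieldTheory.Balaban1983to89.B5SettingP12Real (LocR latticeSettingP12R e_R suppIn_R supNorm_R)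
open Literature.MathematicalPhysics.QuantumFieldTheory.Balaban1983to89.B5SiteBridgeP12 (nP MP)
open Literature.MathematicalPhysics.QuantumFieldTheory.Balaban1983to89.B5ResidualGpTorusHolds (TopIdx)
open Literature.MathematicalPhysics.QuantumFieldTheory.Balaban1983to89.B5Prop12GLattice (famG)
open Literature.MathematicalPhysics.QuantumFieldTheory.Balaban1983to89.B5Prop12GHolds (prop12_famG_printed)
open Literature.MathematicalPhysics.QuantumFieldTheory.Balaban1983to89.LatticeNorms (supNorm norm_le_supNorm supNorm_le supNorm_nonneg)
open Literature.MathematicalPhysics.QuantumFieldTheory.King1986.Torus (blockOf val_blockOf tdistT tdistT_nonneg toSite one_le_period)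
open Literature.MathematicalPhysics.QuantumFieldTheory.Balaban1983to89.B6UnitTorusCarrier (unitTorusGeo unitTorusGeo_dist)
open Summit.QuantumFields.YangMills.BalabanUVNodes.N15.VectorPiece (blkFine)

variable {d : ℕ}

/-! ## §13 Geometry bridges: King's block lies in Bałaban's doubled cube; the two unit-lattice sup distances agree -/

section Bridges

variable (M : Fin (d + 1) → ℕ) [∀ μ, NeZero (M μ)] (n : ℕ) [NeZero n]

/-- King's block label `blockOf` (`⌊·∕n⌋`, `King1986.TorusBlockForm`) IS b05's `B5Cube1Partition.blockLabel`. [folklore] -/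
theorem blockLabel_eq_blockOf (x : Tor (fine n M)) : blockLabel M n x = blockOf n M x := by
  funext μ
  apply ZMod.val_injective
  rw [blockLabel_val, val_blockOf]

/-- **KING's BLOCK `B(y)` LIES IN BAŁABAN's DOUBLED CUBE `Δ̃(y)`**: `x ∈ cubeT n M (blockOf n M x)`. [cite: Balaban1984PropagatorsI, p.35 (the cubes Δ(y) ⊂ Δ̃(y))] -/
theorem mem_cubeT_blockOf (hn : 1 ≤ n) (x : Tor (fine n M)) : x ∈ cubeT n M (blockOf n M x) :=
  cube1_subset_cubeT M n hn _ ((mem_cube1_iff M n x _).mpr (blockLabel_eq_blockOf M n x))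

/-- **THE TWO UNIT-LATTICE SUP DISTANCES AGREE**: b05's `distSite M` (sup of `|valMinAbs|`) IS King's `tdistT M` (sup of circular coordinate distances).
[folklore] -/
theorem distSite_eq_tdistT (y y' : Tor M) : distSite M y y' = tdistT M y y' := by
  unfold distSite tdistT B4Sect5Torus.tdist
  congr 1
  refine congrArg _ (funext fun μ => ?_)
  have h1 := B5Ineq110P12Lattice.natAbs_valMinAbs_intCast_sub (N := M μ) ((y μ).val : ℤ) ((y' μ).val : ℤ)
  simp only [Int.cast_natCast, ZMod.natCast_zmod_val] at h1
  have h2 := B4Sect5Torus.ccoord_cast (one_le_period M) (toSite M y) (toSite M y') μ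
  have h3 : ((B4Sect5Torus.ccoord M (toSite M y) (toSite M y') μ : ℕ) : ℤ) =
      ((((y μ - y' μ).valMinAbs).natAbs : ℕ) : ℤ) := by
    rw [h2, h1]; rfl
  exact_mod_cast h3.symm

end Bridges

/-! ## §14 Bałaban's `G = Δ_a⁻¹` as a REAL linear operator on real 1-forms (`B5RealFields.GR`), its forward differences and the (1.110) entries -/

section RealG

variable (M : Fin (d + 1) → ℕ) [∀ μ, NeZero (M μ)] (n : ℕ) [NeZero n] (a : ℝ)

/-- **`G = Δ_a⁻¹` ON REAL 1-FORMS**: `Matrix.mulVecLin (B5RealFields.GR n M a)` (`GR = reM (DeltaA n M a)⁻¹`, real because `Δ_a` is). [cite: Balaban1984PropagatorsI, (1.71) p.30 («Δ_a⁻¹ = G_k, or simply G»)] -/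
def gOp : (Tor (fine n M) × Fin (d + 1) → ℝ) →ₗ[ℝ] (Tor (fine n M) × Fin (d + 1) → ℝ) := Matrix.mulVecLin (GR n M a)

/-- **`Δ_a` ON REAL 1-FORMS**: `Matrix.mulVecLin (B5RealFields.DeltaAR n M a)`. [cite: Balaban1984PropagatorsI, (1.69) p.29] -/
def deltaOp : (Tor (fine n M) × Fin (d + 1) → ℝ) →ₗ[ℝ] (Tor (fine n M) × Fin (d + 1) → ℝ) := Matrix.mulVecLin (DeltaAR n M a)

/-- DICTIONARY: the complex matrix `(DeltaA n M a)⁻¹` applied to an embedded real 1-form is the embedding of `gOp`. [cite: Balaban1984PropagatorsI, (1.71) p.30] -/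
theorem DeltaA_inv_mulVec_ofReal (u : Tor (fine n M) × Fin (d + 1) → ℝ) (b : Tor (fine n M) × Fin (d + 1)) :
    ((DeltaA n M a)⁻¹ *ᵥ (fun i => (u i : ℂ))) b = ((gOp M n a u b : ℝ) : ℂ) := by
  rw [← GR_map_ofReal, gOp, Matrix.mulVecLin_apply]
  simp only [Matrix.mulVec, dotProduct, Matrix.map_apply, Complex.ofReal_sum, Complex.ofReal_mul]

/-- `G Δ_a = 1` on real 1-forms (for `idef_inv`'s left-inverse slot). [cite: Balaban1984PropagatorsI, (1.71) p.30] -/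
theorem gOp_comp_deltaOp (hn : 1 ≤ n) (ha : 0 < a) : gOp M n a ∘ₗ deltaOp M n a = LinearMap.id := by
  rw [gOp, deltaOp, ← Matrix.mulVecLin_mul, GR_mul_DeltaAR n hn M a ha, Matrix.mulVecLin_one]

/-- `Δ_a G = 1` on real 1-forms (for `idef_inv`'s right-inverse slot). [cite: Balaban1984PropagatorsI, (1.71) p.30] -/
theorem deltaOp_comp_gOp (hn : 1 ≤ n) (ha : 0 < a) : deltaOp M n a ∘ₗ gOp M n a = LinearMap.id := by
  rw [gOp, deltaOp, ← Matrix.mulVecLin_mul, DeltaAR_mul_GR n hn M a ha, Matrix.mulVecLin_one]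

end RealG

/-! ## §15 The torus family of record in dimension `d + 1` and (1.110) ENTRY 0 of `G` as a block majorant on the N15 carrier -/

section Entry0

variable (d)

/-- Bałaban's volume parameters for the N15 carrier: dimension `d + 1`, block factor `L`, torus exponent `m` (periods `2L^m`), top scale `K`. [cite: Balaban1984PropagatorsI, p.35 (ε = L^{−K}, the tori)] -/
def paramsOf (L m K : ℕ) (hL : Odd L ∧ 1 < L) : Params := ⟨d + 1, L, m, K, Nat.succ_pos d, hL⟩

/-- … as an index of the top-level family `famG (d + 1) L a` (`K ≥ 1`). [cite: Balaban1984PropagatorsI, Prop. 1.2 p.35] -/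
def topIdxOf (L m K : ℕ) (hL : Odd L ∧ 1 < L) (hK : 1 ≤ K) : TopIdx (d + 1) L := ⟨paramsOf d L m K hL, rfl, rfl, hK⟩

variable {d}

/-- The family member at `topIdxOf` IS the real setting at `n = L^K`, `M_μ = 2L^m` (`rfl`). [folklore] -/
theorem famG_topIdxOf (L m K : ℕ) [NeZero L] (hL : Odd L ∧ 1 < L) (hK : 1 ≤ K) (a : ℝ) :
    famG (d + 1) L a (topIdxOf d L m K hL hK) = latticeSettingP12R (L ^ K) (MP (paramsOf d L m K hL)) a K := rfl

/-- ★ **(1.110) ENTRY 0 OF `G = Δ_a⁻¹` AS A BLOCK MAJORANT ON THE N15 CARRIER, HYPOTHESIS-FREE**: for odd `L > 1` and `a > 0` there are `δ₀, C > 0` such that for EVERY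
torus exponent `m` and EVERY top scale `K ≥ 1`, the real operator `G = gOp (2L^m) (L^K) a` has the block majorant `C·e^{−δ₀|y−y′|_T}` between the sharp unit-block sup
norms of fine 1-forms (`BlockNorm.ofBlocks (unitTorusGeo L K M) blkFine`) — Bałaban's PROPOSITION 1.2 (1.110), first entry, for the torus family of record
(`B5Prop12GHolds.prop12_famG_printed`, kernel-proved in the tree) READ in the N15 lineage's currency: King's block `B(y′) ⊂ Δ̃(y′)` carries the source, `B(y) ⊂ Δ̃(y)` the
observation, `|y − y′|` = `tdistT` (`distSite_eq_tdistT`). [cite: Balaban1984PropagatorsI, Prop. 1.2 (1.110) p.35] -/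
theorem hasMaj_gOp {L : ℕ} [NeZero L] (hL : Odd L ∧ 1 < L) {a : ℝ} (ha : 0 < a) :
    ∃ δ₀ C : ℝ, 0 < δ₀ ∧ 0 < C ∧ ∀ (m K : ℕ) (hK : 1 ≤ K),
      HasMaj (BlockNorm.ofBlocks (unitTorusGeo L K (MP (paramsOf d L m K hL))) (blkFine L K (MP (paramsOf d L m K hL))))
        (BlockNorm.ofBlocks (unitTorusGeo L K (MP (paramsOf d L m K hL))) (blkFine L K (MP (paramsOf d L m K hL))))
        (gOp (MP (paramsOf d L m K hL)) (L ^ K) a)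
        (fun y y' => C * Real.exp (-(δ₀ * tdistT (MP (paramsOf d L m K hL)) y y'))) := by
  obtain ⟨δ₀, C, Cα, Cε, Cαε, hδ₀, hC, H⟩ := prop12_famG_printed (d := d + 1) (L := L) (Nat.succ_pos d) hL ha
  refine ⟨δ₀, C, hδ₀, hC, fun m K hK => ?_⟩
  set M : Fin (d + 1) → ℕ := MP (paramsOf d L m K hL) with hM
  have h110 := (H (topIdxOf d L m K hL hK)).1
  intro y' μ hμ y
  -- the source `J := μ` embedded, localised in King's block `B(y′) ⊂ Δ̃(y′)`
  have hsupp : suppInL (L ^ K) M (LocR.vec μ).emb y' := by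
    intro b hb
    have hby : blkFine L K M b = y' := by
      by_contra h
      exact hb (show ((μ b : ℝ) : ℂ) = 0 by rw [hμ b h, Complex.ofReal_zero])
    rw [← hby]
    exact mem_cubeT_blockOf M (L ^ K) (Nat.one_le_pow _ _ (Nat.pos_of_ne_zero (NeZero.ne L))) b.1
  have hineq : eL (L ^ K) M a 0 (LocR.vec μ).emb y ≤ C * Real.exp (-(δ₀ * distSite M y y')) * supNormL (L ^ K) M (LocR.vec μ).emb :=
    h110 0 (LocR.vec μ) y y' hsupp
  -- the source size: `supNormL ≤ loc y′ μ`
  have hsrc : supNormL (L ^ K) M (LocR.vec μ).emb ≤ (BlockNorm.ofBlocks (unitTorusGeo L K M) (blkFine L K M)).loc y' μ := by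
    refine supNorm_le ((BlockNorm.ofBlocks (unitTorusGeo L K M) (blkFine L K M)).loc_nonneg y' μ) fun b _ => ?_
    show ‖((μ b : ℝ) : ℂ)‖ ≤ _
    by_cases hb : blkFine L K M b = y'
    · rw [Complex.norm_real, Real.norm_eq_abs]
      exact abs_le_loc_ofBlocks (g := unitTorusGeo L K M) (blkFine L K M) μ hb
    · rw [hμ b hb, Complex.ofReal_zero, norm_zero]
      exact (BlockNorm.ofBlocks (unitTorusGeo L K M) (blkFine L K M)).loc_nonneg y' μ
  -- the observation: every fine bond of King's block `B(y)` lies in `Δ̃(y)`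
  refine loc_ofBlocks_le (g := unitTorusGeo L K M) (blkFine L K M) _
    (mul_nonneg (mul_nonneg hC.le (Real.exp_nonneg _)) ((BlockNorm.ofBlocks (unitTorusGeo L K M) (blkFine L K M)).loc_nonneg y' μ)) fun b hb => ?_
  have hbc : b ∈ cubeB (L ^ K) M y := by
    refine Finset.mem_product.mpr ⟨?_, Finset.mem_univ _⟩
    rw [← hb]
    exact mem_cubeT_blockOf M (L ^ K) (Nat.one_le_pow _ _ (Nat.pos_of_ne_zero (NeZero.ne L))) b.1
  have hobs : |gOp M (L ^ K) a μ b| ≤ eL (L ^ K) M a 0 (LocR.vec μ).emb y := by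
    have h := norm_le_supNorm ((DeltaA (L ^ K) M a)⁻¹ *ᵥ fun i => ((μ i : ℝ) : ℂ)) hbc
    have e := DeltaA_inv_mulVec_ofReal M (L ^ K) a μ b
    rw [e, Complex.norm_real, Real.norm_eq_abs] at h
    exact h
  calc |gOp M (L ^ K) a μ b| ≤ eL (L ^ K) M a 0 (LocR.vec μ).emb y := hobs
    _ ≤ C * Real.exp (-(δ₀ * distSite M y y')) * supNormL (L ^ K) M (LocR.vec μ).emb := hineq
    _ ≤ C * Real.exp (-(δ₀ * tdistT M y y')) * (BlockNorm.ofBlocks (unitTorusGeo L K M) (blkFine L K M)).loc y' μ := by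
        rw [distSite_eq_tdistT]
        exact mul_le_mul_of_nonneg_left hsrc (mul_nonneg hC.le (Real.exp_nonneg _))

end Entry0

/-! ## §16 Dictionaries for the difference quotients: b05's `fdiff` ∕ `fdiffᴴ` on embedded real 1-forms are `ρ(n(s_ν − 1))` ∕ `ρ(n(s_ν⁻¹ − 1))` -/

section DiffDict

variable (M : Fin (d + 1) → ℕ) [∀ μ, NeZero (M μ)] (n : ℕ) [NeZero n]

/-- `∇_ν` (b05's `fdiff (fine n M) n ν`) on an embedded real 1-form is the embedding of `ρ(n(s_ν − 1))`. [cite: Balaban1984PropagatorsI, (1.31) p.23] -/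
theorem fdiff_mulVec_ofReal (ν : Fin (d + 1)) (u : Tor (fine n M) × Fin (d + 1) → ℝ) (b : Tor (fine n M) × Fin (d + 1)) :
    (fdiff (fine n M) ((n : ℕ) : ℂ) ν *ᵥ fun i => ((u i : ℝ) : ℂ)) b = ((symbOp M n (sD M n ν n) u b : ℝ) : ℂ) := by
  obtain ⟨x, κ⟩ := b
  rw [symbOp_sD_apply, fdiff, Matrix.smul_mulVec, Pi.smul_apply, Matrix.sub_mulVec, Pi.sub_apply, Matrix.one_mulVec,
    B5Action121.shiftM_mulVec, smul_eq_mul]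
  push_cast
  ring

/-- `∇_ν^*` (b05's `star (fdiff (fine n M) n ν)`, the conjugate transpose) on an embedded real 1-form is the embedding of `ρ(n(s_ν⁻¹ − 1))` (backward
difference quotient, up to sign convention `∇* = −S⁻¹∇`). [cite: Balaban1984PropagatorsI, (1.21) p.21 (the adjoint ∂*)] -/
theorem star_fdiff_mulVec_ofReal (ν : Fin (d + 1)) (u : Tor (fine n M) × Fin (d + 1) → ℝ) (b : Tor (fine n M) × Fin (d + 1)) :
    (star (fdiff (fine n M) ((n : ℕ) : ℂ) ν) *ᵥ fun i => ((u i : ℝ) : ℂ)) b = ((symbOp M n ((n : ℝ) • (sTinv M n ν - 1)) u b : ℝ) : ℂ) := by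
  classical
  obtain ⟨x, κ⟩ := b
  have hρ : symbOp M n ((n : ℝ) • (sTinv M n ν - 1)) u (x, κ) = n * (u (x - unitVec (fine n M) ν, κ) - u (x, κ)) := by
    rw [map_smul, map_sub, map_one, LinearMap.smul_apply, LinearMap.sub_apply, Module.End.one_apply, Pi.smul_apply, Pi.sub_apply, smul_eq_mul,
      symbOp_sTinv_apply]
  rw [hρ, Matrix.star_eq_conjTranspose, fdiff, Matrix.conjTranspose_smul, Matrix.conjTranspose_sub, Matrix.conjTranspose_one, Matrix.smul_mulVec,
    Pi.smul_apply, Matrix.sub_mulVec, Pi.sub_apply, Matrix.one_mulVec, smul_eq_mul]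
  have hsh : ((B5Prop11Plancherel.shiftM (fine n M) ν)ᴴ *ᵥ fun i => ((u i : ℝ) : ℂ)) (x, κ) = ((u (x - unitVec (fine n M) ν, κ) : ℝ) : ℂ) := by
    rw [Matrix.mulVec, dotProduct, Finset.sum_eq_single (x - unitVec (fine n M) ν, κ)]
    · simp [Matrix.conjTranspose_apply, B5Prop11Plancherel.shiftM, sub_add_cancel]
    · rintro ⟨j1, j2⟩ _ hj
      rw [Matrix.conjTranspose_apply]
      simp only [B5Prop11Plancherel.shiftM]
      rw [if_neg, star_zero, zero_mul]
      intro h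
      simp only [Prod.mk.injEq] at h
      exact hj (by rw [h.1, h.2, add_sub_cancel_right])
    · intro h; exact absurd (Finset.mem_univ _) h
  rw [hsh]
  push_cast
  simp

end DiffDict

/-! ## §17 (1.110) ENTRIES 1 AND 2: `∇_νG` and `G∇_ν^*` as block majorants on the N15 carrier, with the SAME constants as entry 0 -/

section Entries12

/-- ★★ **THE THREE (1.110) SUP ENTRIES OF `G = Δ_a⁻¹` AS BLOCK MAJORANTS ON THE N15 CARRIER, ONE PAIR OF CONSTANTS, HYPOTHESIS-FREE**: for odd `L > 1`, `a > 0` there are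
`δ₀, C > 0` such that for every torus exponent `m`, top scale `K ≥ 1` and direction `ν`, on the unit-torus carrier with fine 1-forms blocked by King's unit blocks:
`G`, `∇_νG = ρ(L^K(s_ν − 1))∘G` and `G∇_ν^* = G∘ρ(L^K(s_ν⁻¹ − 1))` all have the block majorant `C·e^{−δ₀|y−y′|_T}` — entries «GJ», «∇GJ», «G∇*J» of Bałaban's (1.110) for
the torus family of record (`B5Prop12GHolds.prop12_famG_printed`), read through `e_R`∕`eL`, `suppIn_R`∕`suppInL`, `supNorm_R`∕`supNormL`, King's block inside `Δ̃`, and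
`distSite = tdistT`. [cite: Balaban1984PropagatorsI, Prop. 1.2 (1.110) p.35] -/
theorem hasMaj_entries110 {L : ℕ} [NeZero L] (hL : Odd L ∧ 1 < L) {a : ℝ} (ha : 0 < a) :
    ∃ δ₀ C : ℝ, 0 < δ₀ ∧ 0 < C ∧ ∀ (m K : ℕ) (hK : 1 ≤ K) (ν : Fin (d + 1)),
      HasMaj (BlockNorm.ofBlocks (unitTorusGeo L K (MP (paramsOf d L m K hL))) (blkFine L K (MP (paramsOf d L m K hL))))
          (BlockNorm.ofBlocks (unitTorusGeo L K (MP (paramsOf d L m K hL))) (blkFine L K (MP (paramsOf d L m K hL))))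
          (symbOp (MP (paramsOf d L m K hL)) (L ^ K) (sD (MP (paramsOf d L m K hL)) (L ^ K) ν ((L ^ K : ℕ) : ℝ)) ∘ₗ
            gOp (MP (paramsOf d L m K hL)) (L ^ K) a)
          (fun y y' => C * Real.exp (-(δ₀ * tdistT (MP (paramsOf d L m K hL)) y y'))) ∧
      HasMaj (BlockNorm.ofBlocks (unitTorusGeo L K (MP (paramsOf d L m K hL))) (blkFine L K (MP (paramsOf d L m K hL))))
          (BlockNorm.ofBlocks (unitTorusGeo L K (MP (paramsOf d L m K hL))) (blkFine L K (MP (paramsOf d L m K hL))))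
          (gOp (MP (paramsOf d L m K hL)) (L ^ K) a ∘ₗ
            symbOp (MP (paramsOf d L m K hL)) (L ^ K) (((L ^ K : ℕ) : ℝ) • (sTinv (MP (paramsOf d L m K hL)) (L ^ K) ν - 1)))
          (fun y y' => C * Real.exp (-(δ₀ * tdistT (MP (paramsOf d L m K hL)) y y'))) := by
  obtain ⟨δ₀, C, Cα, Cε, Cαε, hδ₀, hC, H⟩ := prop12_famG_printed (d := d + 1) (L := L) (Nat.succ_pos d) hL ha
  refine ⟨δ₀, C, hδ₀, hC, fun m K hK ν => ?_⟩
  set M : Fin (d + 1) → ℕ := MP (paramsOf d L m K hL) with hM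
  have hn : 1 ≤ L ^ K := Nat.one_le_pow _ _ (Nat.pos_of_ne_zero (NeZero.ne L))
  have h110 := (H (topIdxOf d L m K hL hK)).1
  have hKnn : ∀ y y' : Tor M, 0 ≤ C * Real.exp (-(δ₀ * tdistT M y y')) := fun y y' => mul_nonneg hC.le (Real.exp_nonneg _)
  -- the embedded G-output of a real 1-form
  have hG : ∀ w : Tor (fine (L ^ K) M) × Fin (d + 1) → ℝ, ((DeltaA (L ^ K) M a)⁻¹ *ᵥ fun i => ((w i : ℝ) : ℂ)) = fun i => ((gOp M (L ^ K) a w i : ℝ) : ℂ) :=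
    fun w => funext fun i => DeltaA_inv_mulVec_ofReal M (L ^ K) a w i
  constructor
  · -- ENTRY 1: `∇_νG`
    intro y' μ hμ y
    have hsupp : suppInL (L ^ K) M (LocR.vec μ).emb y' := by
      intro b hb
      have hby : blkFine L K M b = y' := by
        by_contra h
        exact hb (show ((μ b : ℝ) : ℂ) = 0 by rw [hμ b h, Complex.ofReal_zero])
      rw [← hby]
      exact mem_cubeT_blockOf M (L ^ K) hn b.1
    have hineq : eL (L ^ K) M a 1 (LocR.vec μ).emb y ≤ C * Real.exp (-(δ₀ * distSite M y y')) * supNormL (L ^ K) M (LocR.vec μ).emb :=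
      h110 1 (LocR.vec μ) y y' hsupp
    have hsrc : supNormL (L ^ K) M (LocR.vec μ).emb ≤ (BlockNorm.ofBlocks (unitTorusGeo L K M) (blkFine L K M)).loc y' μ := by
      refine supNorm_le ((BlockNorm.ofBlocks (unitTorusGeo L K M) (blkFine L K M)).loc_nonneg y' μ) fun b _ => ?_
      show ‖((μ b : ℝ) : ℂ)‖ ≤ _
      by_cases hb : blkFine L K M b = y'
      · rw [Complex.norm_real, Real.norm_eq_abs]
        exact abs_le_loc_ofBlocks (g := unitTorusGeo L K M) (blkFine L K M) μ hb
      · rw [hμ b hb, Complex.ofReal_zero, norm_zero]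
        exact (BlockNorm.ofBlocks (unitTorusGeo L K M) (blkFine L K M)).loc_nonneg y' μ
    refine loc_ofBlocks_le (g := unitTorusGeo L K M) (blkFine L K M) _
      (mul_nonneg (hKnn y y') ((BlockNorm.ofBlocks (unitTorusGeo L K M) (blkFine L K M)).loc_nonneg y' μ)) fun b hb => ?_
    have hbc : (ν, b) ∈ Finset.univ ×ˢ cubeB (L ^ K) M y := by
      refine Finset.mem_product.mpr ⟨Finset.mem_univ _, Finset.mem_product.mpr ⟨?_, Finset.mem_univ _⟩⟩
      rw [← hb]
      exact mem_cubeT_blockOf M (L ^ K) hn b.1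
    have hobs : |(symbOp M (L ^ K) (sD M (L ^ K) ν ((L ^ K : ℕ) : ℝ)) ∘ₗ gOp M (L ^ K) a) μ b| ≤ eL (L ^ K) M a 1 (LocR.vec μ).emb y := by
      have h := norm_le_supNorm
        (fun p : Fin (d + 1) × (Tor (fine (L ^ K) M) × Fin (d + 1)) =>
          B5Prop11Lattice.grad (L ^ K) M ((DeltaA (L ^ K) M a)⁻¹ *ᵥ fun i => ((μ i : ℝ) : ℂ)) p.1 p.2) hbc
      have e : B5Prop11Lattice.grad (L ^ K) M ((DeltaA (L ^ K) M a)⁻¹ *ᵥ fun i => ((μ i : ℝ) : ℂ)) ν b =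
          (((symbOp M (L ^ K) (sD M (L ^ K) ν ((L ^ K : ℕ) : ℝ)) ∘ₗ gOp M (L ^ K) a) μ b : ℝ) : ℂ) := by
        rw [B5Prop11Lattice.grad, hG, fdiff_mulVec_ofReal, LinearMap.comp_apply]
      simp only at h
      rw [e, Complex.norm_real, Real.norm_eq_abs] at h
      exact h
    calc |(symbOp M (L ^ K) (sD M (L ^ K) ν ((L ^ K : ℕ) : ℝ)) ∘ₗ gOp M (L ^ K) a) μ b| ≤ eL (L ^ K) M a 1 (LocR.vec μ).emb y := hobs
      _ ≤ C * Real.exp (-(δ₀ * distSite M y y')) * supNormL (L ^ K) M (LocR.vec μ).emb := hineq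
      _ ≤ C * Real.exp (-(δ₀ * tdistT M y y')) * (BlockNorm.ofBlocks (unitTorusGeo L K M) (blkFine L K M)).loc y' μ := by
          rw [distSite_eq_tdistT]
          exact mul_le_mul_of_nonneg_left hsrc (hKnn y y')
  · -- ENTRY 2: `G∇_ν^*` with the tensor source carrying `μ` in slot `ν` only
    intro y' μ hμ y
    set Jt : LocR (L ^ K) M := LocR.ten fun ν' => if ν' = ν then μ else 0 with hJt
    have hsupp : suppInL (L ^ K) M Jt.emb y' := by
      intro ν' b hb
      have hby : blkFine L K M b = y' := by
        by_contra h
        refine hb ?_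
        show (((if ν' = ν then μ else 0) b : ℝ) : ℂ) = 0
        split_ifs
        · rw [hμ b h, Complex.ofReal_zero]
        · rw [Pi.zero_apply, Complex.ofReal_zero]
      rw [← hby]
      exact mem_cubeT_blockOf M (L ^ K) hn b.1
    have hineq : eL (L ^ K) M a 2 Jt.emb y ≤ C * Real.exp (-(δ₀ * distSite M y y')) * supNormL (L ^ K) M Jt.emb :=
      h110 2 Jt y y' hsupp
    have hsrc : supNormL (L ^ K) M Jt.emb ≤ (BlockNorm.ofBlocks (unitTorusGeo L K M) (blkFine L K M)).loc y' μ := by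
      refine supNorm_le ((BlockNorm.ofBlocks (unitTorusGeo L K M) (blkFine L K M)).loc_nonneg y' μ) fun p _ => ?_
      show ‖(((if p.1 = ν then μ else 0) p.2 : ℝ) : ℂ)‖ ≤ _
      split_ifs
      · by_cases hb : blkFine L K M p.2 = y'
        · rw [Complex.norm_real, Real.norm_eq_abs]
          exact abs_le_loc_ofBlocks (g := unitTorusGeo L K M) (blkFine L K M) μ hb
        · rw [hμ p.2 hb, Complex.ofReal_zero, norm_zero]
          exact (BlockNorm.ofBlocks (unitTorusGeo L K M) (blkFine L K M)).loc_nonneg y' μ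
      · rw [Pi.zero_apply, Complex.ofReal_zero, norm_zero]
        exact (BlockNorm.ofBlocks (unitTorusGeo L K M) (blkFine L K M)).loc_nonneg y' μ
    refine loc_ofBlocks_le (g := unitTorusGeo L K M) (blkFine L K M) _
      (mul_nonneg (hKnn y y') ((BlockNorm.ofBlocks (unitTorusGeo L K M) (blkFine L K M)).loc_nonneg y' μ)) fun b hb => ?_
    have hbc : b ∈ cubeB (L ^ K) M y := by
      refine Finset.mem_product.mpr ⟨?_, Finset.mem_univ _⟩
      rw [← hb]
      exact mem_cubeT_blockOf M (L ^ K) hn b.1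
    -- the divergence of the tensor source is the adjoint difference of `μ`
    have hdiv : B5Prop11Lattice.divT (L ^ K) M (fun s b' => (((if s = ν then μ else 0) b' : ℝ) : ℂ)) =
        fun i => ((symbOp M (L ^ K) (((L ^ K : ℕ) : ℝ) • (sTinv M (L ^ K) ν - 1)) μ i : ℝ) : ℂ) := by
      rw [B5Prop11Lattice.divT, Finset.sum_eq_single ν (fun s _ hs => by
          rw [show (fun b' => (((if s = ν then μ else 0) b' : ℝ) : ℂ)) = 0 from funext fun b' => by simp [hs], Matrix.mulVec_zero])
        (fun h => absurd (Finset.mem_univ ν) h)]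
      funext i
      rw [show (fun b' => (((if ν = ν then μ else 0) b' : ℝ) : ℂ)) = fun b' => ((μ b' : ℝ) : ℂ) from funext fun b' => by simp,
        star_fdiff_mulVec_ofReal]
    have hobs : |(gOp M (L ^ K) a ∘ₗ symbOp M (L ^ K) (((L ^ K : ℕ) : ℝ) • (sTinv M (L ^ K) ν - 1))) μ b| ≤ eL (L ^ K) M a 2 Jt.emb y := by
      have h := norm_le_supNorm
        ((DeltaA (L ^ K) M a)⁻¹ *ᵥ B5Prop11Lattice.divT (L ^ K) M (fun s b' => (((if s = ν then μ else 0) b' : ℝ) : ℂ))) hbc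
      have e : ((DeltaA (L ^ K) M a)⁻¹ *ᵥ B5Prop11Lattice.divT (L ^ K) M (fun s b' => (((if s = ν then μ else 0) b' : ℝ) : ℂ))) b =
          (((gOp M (L ^ K) a ∘ₗ symbOp M (L ^ K) (((L ^ K : ℕ) : ℝ) • (sTinv M (L ^ K) ν - 1))) μ b : ℝ) : ℂ) := by
        rw [hdiv, hG, LinearMap.comp_apply]
      rw [e, Complex.norm_real, Real.norm_eq_abs] at h
      exact h
    calc |(gOp M (L ^ K) a ∘ₗ symbOp M (L ^ K) (((L ^ K : ℕ) : ℝ) • (sTinv M (L ^ K) ν - 1))) μ b| ≤ eL (L ^ K) M a 2 Jt.emb y := hobs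
      _ ≤ C * Real.exp (-(δ₀ * distSite M y y')) * supNormL (L ^ K) M Jt.emb := hineq
      _ ≤ C * Real.exp (-(δ₀ * tdistT M y y')) * (BlockNorm.ofBlocks (unitTorusGeo L K M) (blkFine L K M)).loc y' μ := by
          rw [distSite_eq_tdistT]
          exact mul_le_mul_of_nonneg_left hsrc (hKnn y y')

end Entries12

end Summit.QuantumFields.YangMills.BalabanUVNodes.N15.TwoGrid
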